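import Literature.Computability.Cryptography.VanDamSeroussiOracleBQP

/-!
# QuantumAdvantage / ArithStatLadder — `AvgFaceBeyondPrior`, line `mirror-unit-signature`:
# the factor-bit language is in `BQP` (part FB of stub `stub_oracleLangMemBQP`, stmt-QuantumAdvantage-2427)

The bit language of the prime factorisation,
`FB = {⟨bin N, u⟩ : bit |u| of code(primeFactorsList N) is 1}` (index in unary = the LENGTH of the
second component, default `0` past the end; the list code `encodingListNatBool.encode = listE natE`
carries a unary length header, so it is recovered from any zero-padded window by `VDSOracle.parseF`),
is in `BQP`:

* Shor's theorem in search form (`isQSolvable_factoring_holds`: on input `x` the family writes, with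
  probability `≥ 2/3`, a string extending `code(primeFactorsList (decodeNat x))`);
* ONE classical wrap (`isQSolvable_classicalWrap_holds`, Bernstein–Vazirani 1997, §8) with the `FP`
  pre-processor `fstF` (`⟨x, u⟩ ↦ x`) and the `FP` post-processor
  `⟨⟨x, u⟩, y⟩ ↦ [wellFormed ∧ bit |u| of certCode (parseF y)]`, `wellFormed` = "the query re-pairs and
  `x` is a canonical numeral" (ill-formed queries are rejected, so that the accepted set is EXACTLY `FB`);
* decision from search (`mem_BQP_of_isQSolvable_bit`).

Pattern: `Theorems/LinnikCubicClassGroupsBitwiseSearchToDecision.lean` (`bitLang_mem_BQP`) and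
`Literature/Computability/Cryptography/VanDamSeroussiOracleBQP.lean` (`lang_mem_BQP`). Everything used is
proved in the tree; no definition, no named fact.
-/

set_option linter.dupNamespace false -- D-0017: single-problem summit ⇒ `QuantumAdvantage.QuantumAdvantage` by design

namespace Summit.QuantumAdvantage.QuantumAdvantage.Theorems.AvgFaceBeyondPrior.Mirror

open _root_.Computability
open Literature.Computability.Complexity Literature.Computability.Cryptography
open Literature.Computability.Complexity.Brick Literature.Computability.Complexity.CodeFP

/-! ### The post-processor, in the typed `CodeFP` algebra -/

/-- `fstF` on strings (private one-liner, as in `VanDamSeroussiOracleFP.lean`). [folklore] -/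
private theorem codeFP_fstF : CodeFP strE strE fstF := ⟨fstF, fstF_mem_FP, fun _ => rfl⟩

/-- `sndF` on strings (private one-liner, as in `VanDamSeroussiOracleFP.lean`). [folklore] -/
private theorem codeFP_sndF : CodeFP strE strE sndF := ⟨sndF, sndF_mem_FP, fun _ => rfl⟩

/-- **The well-formedness test of a query is polynomial time**: `w` re-pairs
(`boolPair (fstF w) (sndF w) = w`) and its first field is a canonical binary numeral
(`encodeNat (bitsToNat (fstF w)) = fstF w`). [folklore] -/
theorem codeFP_wellFormed : CodeFP strE bitE (fun w =>
    decide (boolPair (fstF w) (sndF w) = w) && decide (encodeNat (bitsToNat (fstF w)) = fstF w)) := by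
  have hpair : CodeFP strE strE (fun w => boolPair (fstF w) (sndF w)) :=
    (codeFP_fstF.pair codeFP_sndF).recodeOut fun _ => rfl
  have hcanon : CodeFP strE strE (fun w => encodeNat (bitsToNat (fstF w))) :=
    (strOfNat.comp (strVal.comp codeFP_fstF)).congr fun _ => rfl
  exact ((CodeFP.eq (eα := strE) Function.injective_id).comp (hpair.pair (CodeFP.id strE))).and
    ((CodeFP.eq (eα := strE) Function.injective_id).comp (hcanon.pair codeFP_fstF))

/-- **The post-processor is polynomial time**: on `v = ⟨w, y⟩`,
`[wellFormed w ∧ bit |sndF w| of certCode (parseF y)]` (`VDSOracle.codeFP_factBit`). (No type ascription on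
the composites: elaborating `comp` against an expected function is a higher-order unification problem.)
[folklore] -/
theorem codeFP_post : CodeFP strE bitE (fun v =>
    (decide (boolPair (fstF (fstF v)) (sndF (fstF v)) = fstF v) &&
        decide (encodeNat (bitsToNat (fstF (fstF v))) = fstF (fstF v))) &&
      (VDSOracle.certCode (VDSOracle.parseF (sndF v))).getD (sndF (fstF v)).length false) := by
  have h1 := codeFP_wellFormed.comp codeFP_fstF
  have h2 := VDSOracle.codeFP_factBit.comp ((strNatLength.comp (codeFP_sndF.comp codeFP_fstF)).pair codeFP_sndF)
  exact (h1.and h2).congr fun _ => rfl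

/-- The post-processor as an `FP` string function with its value on pairs. [folklore] -/
theorem exists_post : ∃ g ∈ FP, ∀ w y : List Bool, g (boolPair w y) =
    [(decide (boolPair (fstF w) (sndF w) = w) && decide (encodeNat (bitsToNat (fstF w)) = fstF w)) &&
      (VDSOracle.certCode (VDSOracle.parseF y)).getD (sndF w).length false] := by
  obtain ⟨g, hg, h⟩ := codeFP_post
  refine ⟨g, hg, fun w y => ?_⟩
  have := h (boolPair w y)
  simp only [fstF_boolPair, sndF_boolPair] at this
  exact this

/-! ### The answer bit decides the language -/

/-- **The answer bit of `FB`**: `wellFormed w ∧ bit |sndF w| of code(primeFactorsList (decodeNat (fstF w)))`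
is `true` iff `w ∈ FB` (pairing and canonical numerals are injective). [folklore] -/
theorem fbBit_eq_true_iff (w : List Bool) :
    ((decide (boolPair (fstF w) (sndF w) = w) && decide (encodeNat (bitsToNat (fstF w)) = fstF w)) &&
        (encodingListNatBool.encode (Nat.primeFactorsList (decodeNat (fstF w)))).getD (sndF w).length false)
      = true ↔
    w ∈ {w : List Bool | ∃ (N : ℕ) (u : List Bool), w = boolPair (encodeNat N) u ∧
      (encodingListNatBool.encode (Nat.primeFactorsList N)).getD u.length false = true} := by
  rw [Set.mem_setOf_eq, Bool.and_eq_true, Bool.and_eq_true, decide_eq_true_eq, decide_eq_true_eq]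
  constructor
  · rintro ⟨⟨hpair, hcanon⟩, hbit⟩
    refine ⟨bitsToNat (fstF w), sndF w, ?_, ?_⟩
    · rw [hcanon, hpair]
    · have h : decodeNat (fstF w) = bitsToNat (fstF w) := by
        conv_lhs => rw [← hcanon]
        exact decode_encodeNat _
      rwa [h] at hbit
  · rintro ⟨N, u, rfl, hbit⟩
    refine ⟨⟨?_, ?_⟩, ?_⟩
    · rw [fstF_boolPair, sndF_boolPair]
    · rw [fstF_boolPair, bitsToNat_encodeNat]
    · rwa [fstF_boolPair, sndF_boolPair, decode_encodeNat]

/-! ### The language is in `BQP` -/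

/-- **The factor-bit language `FB = {⟨bin N, u⟩ : bit |u| of code(primeFactorsList N) = 1}` is in `BQP`**
(Shor + one classical wrap + decision from search). [folklore] -/
theorem factorBitsLang_mem_BQP :
    ({w : List Bool | ∃ (N : ℕ) (u : List Bool), w = boolPair (encodeNat N) u ∧
      (encodingListNatBool.encode (Nat.primeFactorsList N)).getD u.length false = true} ∈ BQP) := by
  obtain ⟨g, hg, hpost⟩ := exists_post
  have hF : IsQSolvable fun x => {y : List Bool | encodingListNatBool.encode (decodeNat x).primeFactorsList <+: y} :=
    isQSolvable_factoring_holds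
  have hW := isQSolvable_classicalWrap_holds fstF g fstF_mem_FP hg hF
  have hbit : IsQSolvable fun w => {z |
      [(decide (boolPair (fstF w) (sndF w) = w) && decide (encodeNat (bitsToNat (fstF w)) = fstF w)) &&
        (encodingListNatBool.encode (Nat.primeFactorsList (decodeNat (fstF w)))).getD (sndF w).length false] <+: z} := by
    refine hW.mono fun w z hz => ?_
    obtain ⟨y, hy, hz⟩ := hz
    rw [Set.mem_setOf_eq, VDSOracle.encode_primeFactorsList_eq] at hy
    obtain ⟨pad, rfl⟩ := hy
    rw [hpost, VDSOracle.parseF_certCode_append] at hz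
    rwa [Set.mem_setOf_eq, VDSOracle.encode_primeFactorsList_eq]
  exact mem_BQP_of_isQSolvable_bit (fun _ _ => QCircuit.outputPMF_apply_holds) cliffordT_isUnitary_holds
    fbBit_eq_true_iff hbit

end Summit.QuantumAdvantage.QuantumAdvantage.Theorems.AvgFaceBeyondPrior.Mirror
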